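import Mathlib
import Summits.Ventures.HodgeRepro2.T6NAut
import Summits.Ventures.HodgeRepro2.T6N2Datum

/-!
# T6NAut2 — the automorphic datum `NAut2 F P` WITH the N2 datum (TARGET-T6 v0.4 §9.2(b), v2)

Cell pub-hodge-repro2, Tier 6 (README §10), seat t6-lead (gen 2). Version 2 of the M2 carrier
`NAut F P` (T6NAut, p401543). What changes and why: v1's richness field `data_surj` («EVERY quadruple
of Schwartz data is realised by an ADMISSIBLE choice», tagged residual IR) is too strong for the host
instantiation — the admissible choices of TIER5 B7(b) / Lemma A7.3(b) are those whose Schwartz data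
lie in the ADMISSIBLE SETS `admA … admD` of the N2 datum (t6-p5's `N2Datum`, p401992), not all of
them. v2 carries the N2 datum `d2 : N2Datum F P d3` and replaces `data_surj` by the CONDITIONAL
richness `data_adm`: under N2's datum-level admissibility `d2.Adm` (= `N2Datum.MuAdmissible ∧
IsIsometric ∧ HChi`, the conclusion of `N2_main`), every quadruple in the admissible sets
(`d2.AdmData`) is the data of an admissible choice. N2 is thereby LOAD-BEARING: the isotypic step
of N3 now has to produce an N2-ADMISSIBLE quadruple with non-zero pairing, and the passage to an
admissible choice consumes `hN2 : M.AdmDatum` (`exists_choice_of_pairing_ne_zero`).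

Everything else is v1 verbatim (same field names, so the owners' side-level statements — N1 on `d1`,
N3 on `d3`, N4 on `sA` / `sB`, N5 on `d5` — read the same); v1 stays in the tree for its consumers
(T6N3Main, T6N4Main, T6Composition, T6PeriodInput, the toys). A v1 carrier yields a v2 carrier with
the N2 datum adjoined (`NAut2.ofNAut`); there is no map back (richness is what v2 refuses to assume).

§8(d): uses an L-value-free non-vanishing device: NO.
-/

namespace Summit.Ventures.HodgeRepro2.T6

open scoped InnerProductSpace

variable {K : Type*} [Field K] [NumberField K] [NumberField.IsCMField K]

/-- THE AUTOMORPHIC DATUM OF THE M2 COMPOSITION, v2: the owners' datum types plus the N2 datum, with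
the richness of the choice dictionary CONDITIONAL on N2 and RESTRICTED to the admissible sets. -/
structure NAut2 (F : FaceSetting K) (P : NDatum F) where
  /-- the N3 datum (t6-p3, `T6N3Datum`): `L²([G])`, `G(𝔸_f)`, the two sides `A` and `B` with their
  Schwartz spaces, theta lifts and toric periods -/
  d3 : N3Datum
  /-- the Schwartz data of a choice `c` of the period datum: `(φ_a, φ_b)` on side A and `(φ_c, φ_d)`
  on side B (t6-p3's choice dictionary, STATUS l. 4764 (3)) -/
  data : P.Choice → d3.A.Sa × d3.A.Sb × d3.B.Sa × d3.B.Sb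
  /-- the N2 datum (t6-p5, `T6N2Datum`): the CM frame `τ`, the sign elements `e₁₁₁`, `e₁₀₀`, the
  similitude scalar `u`, the characters, and the admissible sets `admA … admD` of Schwartz data -/
  d2 : N2Datum F P d3
  /-- `[compat: owners t6-lead, t6-p5, t6-p3; discharged at: B7(b) / Lemma A7.3(b) on the host]`
  CONDITIONAL RICHNESS: under N2's datum-level admissibility, every quadruple of Schwartz data in the
  admissible sets is the data of an admissible choice -/
  data_adm : d2.Adm → ∀ (φa : d3.A.Sa) (φb : d3.A.Sb) (φc : d3.B.Sa) (φd : d3.B.Sb),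
    d2.AdmData (φa, φb, φc, φd) → ∃ c, P.AdmChoice c ∧ data c = (φa, φb, φc, φd)
  /-- the N1 datum (t6-p1, `T6N1Datum`) in N3's parameter shape: `LG = L²([G])`,
  `F_A c = F_A(φ_a, φ_b) = η_a η_b`, `F_B c = F_B(φ_c, φ_d) = η_{c̄} η_{d̄}` at the Schwartz data of `c` -/
  d1 : N1Datum F P d3.LG (fun c => d3.A.F (data c).1 (data c).2.1)
    (fun c => d3.B.F (data c).2.2.1 (data c).2.2.2)
  /-- the N4 data of side A (`π₀` on `W_A = W₁₂`) -/
  sA : NSide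
  /-- the N4 data of side B (`π₀′` on `W_B = W₃₄`) -/
  sB : NSide
  /-- the index type of the toric data of N5 -/
  ι5 : Type
  /-- the (abelian) torus of N5 -/
  G5 : Type
  [instG5 : CommGroup G5]
  /-- the N5 datum (t6-p7, `T6N5Skeleton`): the two toric sides with the same `β` and the same
  splitting character `f` -/
  d5 : N5Skeleton.N5Data ι5 G5
  /-- `[compat: owners t6-p3, t6-p7; discharged at: residual IR]` N5's conclusion on side A is
  Proposition N*'s hypothesis (ii) for side A in N3's words (`N3Side.hypII`) -/
  hypII_A_of_N5 : d5.A.levelPeriodNonzero → d3.A.hypII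
  /-- `[compat: owners t6-p3, t6-p7; discharged at: residual IR]` the same on side B -/
  hypII_B_of_N5 : d5.B.levelPeriodNonzero → d3.B.hypII

namespace NAut2

variable {F : FaceSetting K} {P : NDatum F} (M : NAut2 F P)

/-- the group structure of the N5 torus (field) -/
instance : CommGroup M.G5 := M.instG5

/-- N2's conclusion for the carrier (`N2_main`'s target): the datum is μ-admissible, `W_B ≅ W_A`,
and (H_χ) holds — `N2Datum.Adm` of the N2 datum. -/
def AdmDatum : Prop := M.d2.Adm

/-- The admissible quadruples of Schwartz data (`N2Datum.AdmData` of the N2 datum). -/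
def AdmData (φ : M.d3.A.Sa × M.d3.A.Sb × M.d3.B.Sa × M.d3.B.Sb) : Prop := M.d2.AdmData φ

/-- Proposition N*'s hypothesis (i) for side A (`N3Side.hypI`). -/
def iA : Prop := M.d3.A.hypI

/-- (i) for side B. -/
def iB : Prop := M.d3.B.hypI

/-- Proposition N*'s hypothesis (ii) for side A (`N3Side.hypII`). -/
def iiA : Prop := M.d3.A.hypII

/-- (ii) for side B. -/
def iiB : Prop := M.d3.B.hypII

/-- Proposition N*'s conclusion for side A: `ℓ_A ≠ 0` (`N3Datum.ellNonzero`). -/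
def ellA : Prop := M.d3.ellNonzero M.d3.A

/-- Proposition N*'s conclusion for side B: `ℓ_B ≠ 0`. -/
def ellB : Prop := M.d3.ellNonzero M.d3.B

/-- N1's pairing `⟨F_A, F_B⟩ = ∫_{[G]} F_A \overline{F_B}` at the choice `c`, in N3's vocabulary
(Mathlib's `⟪x, y⟫_ℂ` is conjugate-linear in `x`: the record's `⟨a, b⟩` is `⟪b, a⟫_ℂ`). -/
noncomputable def pairing (c : P.Choice) : ℂ :=
  ⟪M.d3.B.F (M.data c).2.2.1 (M.data c).2.2.2, M.d3.A.F (M.data c).1 (M.data c).2.1⟫_ℂ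

/-- `NAut2.pairing` is the N1 datum's pairing. -/
theorem pairing_eq (c : P.Choice) : M.pairing c = M.d1.pairing c := rfl

/-- THE ISOTYPIC STEP OF N3 IN THE CHOICE FORM, v2 — N2 LOAD-BEARING: under N2's datum-level
admissibility, if some N2-ADMISSIBLE quadruple of Schwartz data `(φ_a, φ_b, φ_c, φ_d)` has a non-zero
pairing `⟨F_A(φ_a, φ_b), F_B(φ_c, φ_d)⟩` (the v2 isotypic statement `N3iso_main₂`), then some
admissible choice `c` of the period datum has `pairing c ≠ 0` — through `data_adm`. -/
theorem exists_choice_of_pairing_ne_zero (hN2 : M.AdmDatum)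
    (h : ∃ (φa : M.d3.A.Sa) (φb : M.d3.A.Sb) (φc : M.d3.B.Sa) (φd : M.d3.B.Sb),
      M.AdmData (φa, φb, φc, φd) ∧ ⟪M.d3.B.F φc φd, M.d3.A.F φa φb⟫_ℂ ≠ 0) :
    ∃ c, P.AdmChoice c ∧ M.pairing c ≠ 0 := by
  obtain ⟨φa, φb, φc, φd, hadm, hne⟩ := h
  obtain ⟨c, hc, hdata⟩ := M.data_adm hN2 φa φb φc φd hadm
  refine ⟨c, hc, ?_⟩
  unfold pairing
  rw [hdata]
  exact hne

/-- N4's conclusion for both sides in N4.1's words. -/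
def N4 : Prop := M.sA.R1AndHloc ∧ M.sB.R1AndHloc

/-- N5's conclusion (t6-p7's `N5Data.N5`): both toric periods are non-zero on the level parts. -/
def N5 : Prop := M.d5.N5

/-- N5 gives Proposition N*'s hypotheses (ii) on both sides, through the compat fields. -/
theorem iiA_and_iiB_of_N5 (h : M.N5) : M.iiA ∧ M.iiB :=
  ⟨M.hypII_A_of_N5 h.1, M.hypII_B_of_N5 h.2⟩

/-- A v1 carrier with an N2 datum adjoined is a v2 carrier: v1's unconditional richness gives the
conditional one. (No map back.) -/
def ofNAut (M₁ : NAut F P) (d2 : N2Datum F P M₁.d3) : NAut2 F P where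
  d3 := M₁.d3
  data := M₁.data
  d2 := d2
  data_adm _ φa φb φc φd _ := M₁.data_surj φa φb φc φd
  d1 := M₁.d1
  sA := M₁.sA
  sB := M₁.sB
  ι5 := M₁.ι5
  G5 := M₁.G5
  instG5 := M₁.instG5
  d5 := M₁.d5
  hypII_A_of_N5 := M₁.hypII_A_of_N5
  hypII_B_of_N5 := M₁.hypII_B_of_N5

/-- `ofNAut` keeps the pairing. -/
theorem ofNAut_pairing (M₁ : NAut F P) (d2 : N2Datum F P M₁.d3) (c : P.Choice) :
    (ofNAut M₁ d2).pairing c = M₁.pairing c := rfl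

end NAut2

/-- THE M2 COMPOSITION, v2 — the logic over `NAut2` with N2 as a binder: from N1, N2 (`M.AdmDatum`),
N3 on both sides with the isotypic step IN ITS DATA FORM (an N2-admissible quadruple with non-zero
pairing), N4 and N5 — an admissible choice `c` with `Hyp.PeriodN (P.shadow c)`. `hN2` is consumed
in the passage from the admissible quadruple to the admissible choice. -/
theorem periodInputN_of_mains₂ {F : FaceSetting K} (P : NDatum F) (M : NAut2 F P)
    (hN1 : ∀ c, P.AdmChoice c → M.pairing c ≠ 0 → P.I P.τ₁ c ≠ 0)
    (hN2 : M.AdmDatum)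
    (hN3A : M.iA → M.iiA → M.ellA) (hN3B : M.iB → M.iiB → M.ellB)
    (hN3iso : M.ellA → M.ellB → ∃ (φa : M.d3.A.Sa) (φb : M.d3.A.Sb) (φc : M.d3.B.Sa) (φd : M.d3.B.Sb),
      M.AdmData (φa, φb, φc, φd) ∧ ⟪M.d3.B.F φc φd, M.d3.A.F φa φb⟫_ℂ ≠ 0)
    (hN4 : M.iA ∧ M.iB) (hN5 : M.N5) :
    ∃ c, P.AdmChoice c ∧ Hyp.PeriodN (P.shadow c) := by
  obtain ⟨hiiA, hiiB⟩ := M.iiA_and_iiB_of_N5 hN5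
  obtain ⟨c, hc, hp⟩ :=
    M.exists_choice_of_pairing_ne_zero hN2 (hN3iso (hN3A hN4.1 hiiA) (hN3B hN4.2 hiiB))
  exact ⟨c, hc, P.periodN_of_I_ne_zero (hN1 c hc hp)⟩

end Summit.Ventures.HodgeRepro2.T6
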